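import Summits.CriticalPhenomena.CardyFormulaZ2.Theorems.CardyTensorRGPolyominoGaussianLawStubDilationEquicontinuityPart1
import Summits.CriticalPhenomena.CardyFormulaZ2.Theorems.CardyTensorRGPolyominoGaussianLawStubDilationEquicontinuityPart2
import Literature.Probability.Percolation.OpenPathAnnulusCrossing
import Literature.Probability.Percolation.QuadCrossingRotationInvarianceProofs

/-!
# Stub `stub_dilationEquicontinuity` of the birth skeleton of the crux `PolyominoGaussianLaw`
# (stmt-CriticalPhenomena-14337, route `CardyTensorRG`) — Part 3: the upper half of the sandwich,
# and tools for the lower half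

**Upper half** (`dl_discreteCrossing_subset_cross`). Sandwich between H21's discrete-arc crossing
event `discreteCrossing` (`Crossings.lean`: an open path of `Ω_δ` from the discrete arc of `(ab)` to
that of `(cd)`) of a framed domain `Ω = Ψ((-1,1)²)`, `(ab) = Ψ`(bottom), `(cd) = Ψ`(top), and
Schramm–Smirnov's crossing events `{ω | ∃ K, Q.IsCrossing K ∧ K ⊆ openEdgeUnion δ ω}` of
parametrised quads (`QuadCrossingSpace.lean`, §1.3 of Schramm–Smirnov 2011): if two points of
`Ψ([-1,1]²)` within `2δ` of each other have model points within `1 - β` of each other (`0 < β`),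
then every configuration with a discrete crossing of `Ω` at mesh `δ` crosses the SHORTER quad
`Ψ([-1,1] × [-β, β])` (sides `0`, `2` the `Ψ`-images of the horizontal sides `im = ∓β`): the ends
of the open `Ω_δ`-path are within one mesh of the two arcs (Part 1), hence below model height `-β`
/ above `β`, the path drawn in the plane lies in `closure Ω ∩ openEdgeUnion δ ω` (Part 1), and its
piece between the last passage at model height `-β` and the first subsequent passage at height `β`
(`exists_Icc_passage`) is a connected compact crossing of the shorter quad inside the open edges.

**Tools for the lower half** (Part 4, `dl_cross_subset_discreteCrossing`). Throughout, the only
metric input is a modulus hypothesis: two points of `Ψ([-1,1]²)` within `r` of each other have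
model points within `κ ≤ 1 - α` of each other.

* `dl_mem_arcs_of_frontier_near` — a frontier point of `Ω` within `r` of a point of model
  abscissa `≤ α` in absolute value lies on one of the two arcs (not on the vertical sides);
* `dl_near_arcs_of_not_mem` — hence a point off `Ω` within `δ < r` of such a point is within `δ`
  of one of the two arcs;
* `dl_dist_arcs_ge`, `dl_not_near_both` — the two arcs are at distance `≥ r`, and sites near the
  two arcs are neither equal nor adjacent;
* `dl_openEdgeUnion_inter_edgeSet` — only lattice bonds of a configuration are drawn;
* exact behaviour of H21's discretisation under dilations `z ↦ t z`, `t > 0`, at the level of the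
  largest component: `meshDomain (t • Ω) δ = meshDomain Ω (δ / t)` (`dl_meshDomain_image_mul`),
  used in the final file to transport the bulk property of the original rectangle to its dilates.

All [folklore]; the combination is the routine deterministic half of "discrete crossing events
are sandwiched by crossing events of perturbed quads" (Schramm–Smirnov 2011, §1.3 and proof of
Lemma 5.1).
-/

noncomputable section

open Set Metric Complex
open scoped unitInterval
open Literature.Probability.LatticeModels Literature.Probability.Percolation
open Literature.Probability.Percolation.QuadCrossing

namespace Summit.CriticalPhenomena.CardyFormulaZ2.Cruxes.PolyominoGaussianLaw.Birth

/-- **A discrete crossing of a framed domain crosses the shorter quad.** See the module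
docstring. [folklore] -/
theorem dl_discreteCrossing_subset_cross (Ψ sc : ℂ ≃ₜ ℂ) {β δ : ℝ} (hβ0 : 0 < β)
    (hsc : ∀ z : ℂ, sc z = ⟨1 * z.re, β * z.im⟩) (hδ : 0 < δ)
    (hη : ∀ z ∈ Ψ '' (Icc (-1 : ℝ) 1 ×ℂ Icc (-1 : ℝ) 1), ∀ z' ∈ Ψ '' (Icc (-1 : ℝ) 1 ×ℂ Icc (-1 : ℝ) 1),
      dist z z' < 2 * δ → dist (Ψ.symm z) (Ψ.symm z') < 1 - β) :
    discreteCrossing (Ψ '' (Ioo (-1 : ℝ) 1 ×ℂ Ioo (-1 : ℝ) 1)) δ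
        (Ψ '' {p : ℂ | p.im = -1 ∧ p.re ∈ Icc (-1 : ℝ) 1})
        (Ψ '' {p : ℂ | p.im = 1 ∧ p.re ∈ Icc (-1 : ℝ) 1}) ⊆
      {ω | ∃ K, (squareModelQuad (sc.trans Ψ)).IsCrossing K ∧ K ⊆ openEdgeUnion δ ω} := by
  intro ω hω
  obtain ⟨x, hx, y, hy, hreach⟩ := hω
  set Ω : Set ℂ := Ψ '' (Ioo (-1 : ℝ) 1 ×ℂ Ioo (-1 : ℝ) 1) with hΩ
  set A : Set ℂ := Ψ '' {p : ℂ | p.im = -1 ∧ p.re ∈ Icc (-1 : ℝ) 1} with hA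
  set B : Set ℂ := Ψ '' {p : ℂ | p.im = 1 ∧ p.re ∈ Icc (-1 : ℝ) 1} with hB
  have hΩo : IsOpen Ω := dl_isOpen_framed Ψ
  have hxΩ : meshPoint δ x ∈ Ω := meshDomain_subset_meshVertices _ _
    (meshBoundary_subset_meshDomain _ _ (discreteArc_subset_meshBoundary _ _ _ hx))
  have hyΩ : meshPoint δ y ∈ Ω := meshDomain_subset_meshVertices _ _
    (meshBoundary_subset_meshDomain _ _ (discreteArc_subset_meshBoundary _ _ _ hy))
  have hxS : meshPoint δ x ∈ Ψ '' (Icc (-1 : ℝ) 1 ×ℂ Icc (-1 : ℝ) 1) := dl_framed_subset_image_Sq Ψ hxΩ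
  have hyS : meshPoint δ y ∈ Ψ '' (Icc (-1 : ℝ) 1 ×ℂ Icc (-1 : ℝ) 1) := dl_framed_subset_image_Sq Ψ hyΩ
  have hAne : A.Nonempty := ⟨Ψ ⟨0, -1⟩, ⟨0, -1⟩, ⟨rfl, by norm_num, by norm_num⟩, rfl⟩
  have hBne : B.Nonempty := ⟨Ψ ⟨0, 1⟩, ⟨0, 1⟩, ⟨rfl, by norm_num, by norm_num⟩, rfl⟩
  -- model heights of the two ends
  have hxim : (Ψ.symm (meshPoint δ x)).im < -β := by
    have h1 : infDist (meshPoint δ x) A ≤ δ := dl_infDist_le_of_mem_discreteArc hΩo hδ.le hx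
    obtain ⟨a, ha, hda⟩ := (infDist_lt_iff hAne).1 (h1.trans_lt (by linarith : δ < 2 * δ))
    have haS : a ∈ Ψ '' (Icc (-1 : ℝ) 1 ×ℂ Icc (-1 : ℝ) 1) := (image_mono dl_bot_subset_Sq) ha
    have hd := hη _ hxS _ haS hda
    have haim : (Ψ.symm a).im = -1 := (dl_symm_mem_of_mem_image Ψ ha).1
    have h2 := abs_im_sub_le_dist_chart (Ψ.symm (meshPoint δ x)) (Ψ.symm a)
    rw [haim] at h2
    have h3 := h2.trans_lt hd
    rw [abs_lt] at h3
    linarith [h3.2]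
  have hyim : β < (Ψ.symm (meshPoint δ y)).im := by
    have h1 : infDist (meshPoint δ y) B ≤ δ := dl_infDist_le_of_mem_discreteArc hΩo hδ.le hy
    obtain ⟨b, hb, hdb⟩ := (infDist_lt_iff hBne).1 (h1.trans_lt (by linarith : δ < 2 * δ))
    have hbS : b ∈ Ψ '' (Icc (-1 : ℝ) 1 ×ℂ Icc (-1 : ℝ) 1) := (image_mono dl_top_subset_Sq) hb
    have hd := hη _ hyS _ hbS hdb
    have hbim : (Ψ.symm b).im = 1 := (dl_symm_mem_of_mem_image Ψ hb).1
    have h2 := abs_im_sub_le_dist_chart (Ψ.symm (meshPoint δ y)) (Ψ.symm b)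
    rw [hbim] at h2
    have h3 := h2.trans_lt hd
    rw [abs_lt] at h3
    linarith [h3.1]
  have hne : x ≠ y := by
    rintro rfl
    linarith
  -- the drawn path and its first passage between the model heights `-β` and `β`
  obtain ⟨W⟩ := hreach
  have J := dl_joinedIn_of_walk W hne
  set γ := J.somePath with hγ
  set f : ℝ → ℝ := fun s => (Ψ.symm (γ.extend s)).im with hf
  have hfc : Continuous f :=
    Complex.continuous_im.comp (Ψ.symm.continuous.comp γ.continuous_extend)
  have hf0 : f 0 ≤ -β := by
    simp only [hf, Path.extend_zero]
    exact hxim.le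
  have hf1 : β ≤ f 1 := by
    simp only [hf, Path.extend_one]
    exact hyim.le
  obtain ⟨t₀, t₁, h0t₀, ht₀₁, ht₁1, hft₀, hft₁, hf01⟩ :=
    exists_Icc_passage zero_le_one hfc.continuousOn hf0 hf1 (by linarith)
  have hγF : ∀ s ∈ Icc (0 : ℝ) 1, γ.extend s ∈ closure Ω ∩ openEdgeUnion δ ω := fun s hs => by
    rw [Path.extend_apply γ hs]
    exact J.somePath_mem _
  have hγS : ∀ s ∈ Icc (0 : ℝ) 1, γ.extend s ∈ Ψ '' (Icc (-1 : ℝ) 1 ×ℂ Icc (-1 : ℝ) 1) :=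
    fun s hs => by rw [← dl_closure_framed]; exact (hγF s hs).1
  have hI : ∀ s ∈ Icc t₀ t₁, s ∈ Icc (0 : ℝ) 1 := fun s hs => ⟨h0t₀.trans hs.1, hs.2.trans ht₁1⟩
  refine ⟨γ.extend '' Icc t₀ t₁, ⟨?_, ?_, ?_, ?_, ?_⟩, ?_⟩
  · exact isCompact_Icc.image γ.continuous_extend
  · exact (isConnected_Icc ht₀₁).image _ γ.continuous_extend.continuousOn
  · rw [dl_carrier_squareModelQuad_scale hsc one_pos hβ0 Ψ]
    rintro _ ⟨s, hs, rfl⟩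
    refine ⟨Ψ.symm (γ.extend s), ⟨?_, ?_⟩, Ψ.apply_symm_apply _⟩
    · have h := (dl_symm_mem_of_mem_image Ψ (hγS s (hI s hs))).1
      simpa using h
    · exact hf01 s hs
  · rw [dl_side_zero_squareModelQuad_scale hsc one_pos Ψ]
    refine ⟨γ.extend t₀, mem_image_of_mem _ (left_mem_Icc.2 ht₀₁), Ψ.symm (γ.extend t₀),
      ⟨hft₀, ?_⟩, Ψ.apply_symm_apply _⟩
    have h := (dl_symm_mem_of_mem_image Ψ (hγS t₀ (hI t₀ (left_mem_Icc.2 ht₀₁)))).1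
    simpa using h
  · rw [dl_side_two_squareModelQuad_scale hsc one_pos Ψ]
    refine ⟨γ.extend t₁, mem_image_of_mem _ (right_mem_Icc.2 ht₀₁), Ψ.symm (γ.extend t₁),
      ⟨hft₁, ?_⟩, Ψ.apply_symm_apply _⟩
    have h := (dl_symm_mem_of_mem_image Ψ (hγS t₁ (hI t₁ (right_mem_Icc.2 ht₀₁)))).1
    simpa using h
  · rintro _ ⟨s, hs, rfl⟩
    exact (hγF s (hI s hs)).2


/-- Only lattice bonds are drawn: the drawn open edges of `ω ∩ E(ℤ²)` are those of `ω`.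
[folklore] -/
theorem dl_openEdgeUnion_inter_edgeSet (δ : ℝ) (ω : BondConfig (Site 2)) :
    openEdgeUnion δ (ω ∩ (zdGraph 2).edgeSet) = openEdgeUnion δ ω := by
  ext z
  simp only [mem_openEdgeUnion_iff, mem_inter_iff, SimpleGraph.mem_edgeSet]
  constructor
  · rintro ⟨x, y, hxy, ⟨hω, -⟩, hz⟩
    exact ⟨x, y, hxy, hω, hz⟩
  · rintro ⟨x, y, hxy, hω, hz⟩
    exact ⟨x, y, hxy, ⟨hω, hxy⟩, hz⟩

section Frame

variable (Ψ : ℂ ≃ₜ ℂ) {α κ r : ℝ}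

/-- **A frontier point near the middle part of the domain lies on one of the two arcs.** If two
points of `Ψ([-1,1]²)` within `r` of each other have model points within `κ ≤ 1 - α` of each
other, then a frontier point of `Ω = Ψ((-1,1)²)` within `r` of a point of `Ψ([-1,1]²)` whose model
abscissa is at most `α` in absolute value lies on `Ψ`(bottom side) or on `Ψ`(top side).
[folklore] -/
theorem dl_mem_arcs_of_frontier_near (hκ : κ ≤ 1 - α)
    (hη : ∀ z ∈ Ψ '' (Icc (-1 : ℝ) 1 ×ℂ Icc (-1 : ℝ) 1), ∀ z' ∈ Ψ '' (Icc (-1 : ℝ) 1 ×ℂ Icc (-1 : ℝ) 1),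
      dist z z' < r → dist (Ψ.symm z) (Ψ.symm z') < κ)
    {b k : ℂ} (hb : b ∈ frontier (Ψ '' (Ioo (-1 : ℝ) 1 ×ℂ Ioo (-1 : ℝ) 1)))
    (hk : k ∈ Ψ '' (Icc (-1 : ℝ) 1 ×ℂ Icc (-1 : ℝ) 1)) (hkre : |(Ψ.symm k).re| ≤ α)
    (hbk : dist b k < r) :
    b ∈ Ψ '' {p : ℂ | p.im = -1 ∧ p.re ∈ Icc (-1 : ℝ) 1} ∨
      b ∈ Ψ '' {p : ℂ | p.im = 1 ∧ p.re ∈ Icc (-1 : ℝ) 1} := by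
  rw [dl_frontier_framed] at hb
  obtain ⟨p, hp, rfl⟩ := hb
  rcases dl_mem_frontier_openSq.1 hp with ⟨⟨h1, h2⟩, h3 | h3⟩ | ⟨h3, h1, h2⟩
  · exact Or.inl ⟨p, ⟨h3, h1, h2⟩, rfl⟩
  · exact Or.inr ⟨p, ⟨h3, h1, h2⟩, rfl⟩
  · exfalso
    have hpS : p ∈ Icc (-1 : ℝ) 1 ×ℂ Icc (-1 : ℝ) 1 := by
      refine ⟨?_, ⟨h1, h2⟩⟩
      rcases h3 with h3 | h3 <;> · rw [mem_preimage, h3]; exact ⟨by norm_num, by norm_num⟩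
    have hd := hη (Ψ p) ⟨p, hpS, rfl⟩ k hk hbk
    rw [Ψ.symm_apply_apply] at hd
    have hre := (abs_re_sub_le_dist_chart p (Ψ.symm k)).trans_lt hd
    have habs : |p.re| = 1 := by
      rcases h3 with h3 | h3 <;> rw [h3] <;> norm_num
    have := abs_sub_abs_le_abs_sub p.re (Ψ.symm k).re
    linarith

/-- **A point off the domain near the middle part of the domain is near one of the two arcs.**
Under the modulus hypothesis, a point `v ∉ Ω` within `δ < r` of a point `k ∈ Ψ([-1,1]²)` of model
abscissa at most `α` in absolute value is within `δ` of `Ψ`(bottom) or of `Ψ`(top): the segment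
`[k, v]` meets the frontier at a point within `δ` of both. [folklore] -/
theorem dl_near_arcs_of_not_mem (hκ : κ ≤ 1 - α)
    (hη : ∀ z ∈ Ψ '' (Icc (-1 : ℝ) 1 ×ℂ Icc (-1 : ℝ) 1), ∀ z' ∈ Ψ '' (Icc (-1 : ℝ) 1 ×ℂ Icc (-1 : ℝ) 1),
      dist z z' < r → dist (Ψ.symm z) (Ψ.symm z') < κ)
    {δ : ℝ} (hδr : δ < r) {v k : ℂ} (hk : k ∈ Ψ '' (Icc (-1 : ℝ) 1 ×ℂ Icc (-1 : ℝ) 1))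
    (hkre : |(Ψ.symm k).re| ≤ α) (hvk : dist v k ≤ δ)
    (hv : v ∉ Ψ '' (Ioo (-1 : ℝ) 1 ×ℂ Ioo (-1 : ℝ) 1)) :
    infDist v (Ψ '' {p : ℂ | p.im = -1 ∧ p.re ∈ Icc (-1 : ℝ) 1}) ≤ δ ∨
      infDist v (Ψ '' {p : ℂ | p.im = 1 ∧ p.re ∈ Icc (-1 : ℝ) 1}) ≤ δ := by
  set Ω : Set ℂ := Ψ '' (Ioo (-1 : ℝ) 1 ×ℂ Ioo (-1 : ℝ) 1) with hΩ
  have hΩo : IsOpen Ω := dl_isOpen_framed Ψ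
  have hδ0 : 0 ≤ δ := dist_nonneg.trans hvk
  -- a frontier point within `δ` of both `v` and `k`
  obtain ⟨b, hbf, hbv, hbk⟩ : ∃ b ∈ frontier Ω, dist v b ≤ δ ∧ dist b k ≤ δ := by
    by_cases hkΩ : k ∈ Ω
    · obtain ⟨b, hbseg, hbf⟩ := Polyomino.exists_mem_segment_mem_frontier hΩo hkΩ hv
      refine ⟨b, hbf, ?_, ?_⟩
      · rw [dist_comm, dist_eq_norm]
        rw [segment_symm] at hbseg
        calc ‖b - v‖ ≤ ‖k - v‖ := norm_sub_le_of_mem_segment hbseg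
          _ = dist v k := by rw [dist_comm, dist_eq_norm]
          _ ≤ δ := hvk
      · rw [dist_eq_norm]
        calc ‖b - k‖ ≤ ‖v - k‖ := norm_sub_le_of_mem_segment hbseg
          _ = dist v k := (dist_eq_norm _ _).symm
          _ ≤ δ := hvk
    · have hkcl : k ∈ closure Ω := by rw [hΩ, dl_closure_framed]; exact hk
      refine ⟨k, ?_, hvk, by rw [dist_self]; exact hδ0⟩
      rw [frontier, hΩo.interior_eq]
      exact ⟨hkcl, hkΩ⟩
  rcases dl_mem_arcs_of_frontier_near Ψ hκ hη hbf hk hkre (hbk.trans_lt hδr) with h | h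
  · exact Or.inl ((infDist_le_dist_of_mem h).trans hbv)
  · exact Or.inr ((infDist_le_dist_of_mem h).trans hbv)

/-- **The two arcs are at distance at least `r`** under the modulus hypothesis (`κ ≤ 1 - α < 2`):
their model points have heights `-1` and `1`. [folklore] -/
theorem dl_dist_arcs_ge (hκ : κ ≤ 1 - α) (hα : 0 < α)
    (hη : ∀ z ∈ Ψ '' (Icc (-1 : ℝ) 1 ×ℂ Icc (-1 : ℝ) 1), ∀ z' ∈ Ψ '' (Icc (-1 : ℝ) 1 ×ℂ Icc (-1 : ℝ) 1),
      dist z z' < r → dist (Ψ.symm z) (Ψ.symm z') < κ)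
    {a b : ℂ} (ha : a ∈ Ψ '' {p : ℂ | p.im = -1 ∧ p.re ∈ Icc (-1 : ℝ) 1})
    (hb : b ∈ Ψ '' {p : ℂ | p.im = 1 ∧ p.re ∈ Icc (-1 : ℝ) 1}) : r ≤ dist a b := by
  by_contra h
  push Not at h
  have hd := hη a (image_mono dl_bot_subset_Sq ha) b (image_mono dl_top_subset_Sq hb) h
  have haim : (Ψ.symm a).im = -1 := (dl_symm_mem_of_mem_image Ψ ha).1
  have hbim : (Ψ.symm b).im = 1 := (dl_symm_mem_of_mem_image Ψ hb).1
  have h2 := abs_im_sub_le_dist_chart (Ψ.symm a) (Ψ.symm b)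
  rw [haim, hbim] at h2
  norm_num at h2
  linarith

/-- **Sites near the two arcs are not adjacent, nor equal** (mesh `δ`, `5δ ≤ r`): a site within
`δ` of `Ψ`(bottom) in `infDist` and a site within `δ` of `Ψ`(top) have mesh points more than `δ`
apart. [folklore] -/
theorem dl_not_near_both (hκ : κ ≤ 1 - α) (hα : 0 < α)
    (hη : ∀ z ∈ Ψ '' (Icc (-1 : ℝ) 1 ×ℂ Icc (-1 : ℝ) 1), ∀ z' ∈ Ψ '' (Icc (-1 : ℝ) 1 ×ℂ Icc (-1 : ℝ) 1),
      dist z z' < r → dist (Ψ.symm z) (Ψ.symm z') < κ)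
    {δ : ℝ} (hδ : 0 < δ) (hδr : 5 * δ ≤ r) {u v : ℂ}
    (hu : infDist u (Ψ '' {p : ℂ | p.im = -1 ∧ p.re ∈ Icc (-1 : ℝ) 1}) ≤ δ)
    (hv : infDist v (Ψ '' {p : ℂ | p.im = 1 ∧ p.re ∈ Icc (-1 : ℝ) 1}) ≤ δ) : δ < dist u v := by
  have hAne : (Ψ '' {p : ℂ | p.im = -1 ∧ p.re ∈ Icc (-1 : ℝ) 1}).Nonempty :=
    ⟨Ψ ⟨0, -1⟩, ⟨0, -1⟩, ⟨rfl, by norm_num, by norm_num⟩, rfl⟩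
  have hBne : (Ψ '' {p : ℂ | p.im = 1 ∧ p.re ∈ Icc (-1 : ℝ) 1}).Nonempty :=
    ⟨Ψ ⟨0, 1⟩, ⟨0, 1⟩, ⟨rfl, by norm_num, by norm_num⟩, rfl⟩
  obtain ⟨a, ha, hda⟩ := (infDist_lt_iff hAne).1 (hu.trans_lt (by linarith : δ < 2 * δ))
  obtain ⟨b, hb, hdb⟩ := (infDist_lt_iff hBne).1 (hv.trans_lt (by linarith : δ < 2 * δ))
  have hab := dl_dist_arcs_ge Ψ hκ hα hη ha hb
  by_contra h
  push Not at h
  have := dist_triangle4 a u v b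
  rw [dist_comm a u] at this
  linarith

end Frame

/-! ### Dilations: `meshDomain (t • Ω) δ = meshDomain Ω (δ / t)` -/

section Dilation

/-- The mesh point at mesh `δ / t` is `t⁻¹` times the mesh point at mesh `δ`. [folklore] -/
theorem dl_meshPoint_div (δ t : ℝ) (x : Site 2) :
    meshPoint (δ / t) x = (t : ℂ)⁻¹ * meshPoint δ x := by
  simp only [meshPoint]
  push_cast
  ring

/-- **Mesh vertices of a dilated domain**: `meshVertices (t • Ω) δ = meshVertices Ω (δ / t)`
(`t > 0`). [folklore] -/
theorem dl_meshVertices_image_mul {Ω : Set ℂ} {t : ℝ} (ht : 0 < t) (δ : ℝ) :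
    meshVertices ((fun z : ℂ => (t : ℂ) * z) '' Ω) δ = meshVertices Ω (δ / t) := by
  have ht' : (t : ℂ) ≠ 0 := by exact_mod_cast ht.ne'
  ext x
  rw [mem_meshVertices_iff, mem_meshVertices_iff, ← Homeomorph.coe_mulLeft₀ (t : ℂ) ht',
    Homeomorph.image_eq_preimage_symm, mem_preimage, Homeomorph.mulLeft₀_symm_apply,
    dl_meshPoint_div δ t]

/-- **Mesh graph of a dilated domain**: `meshGraph (t • Ω) δ = meshGraph Ω (δ / t)` (`t > 0`).
[folklore] -/
theorem dl_meshGraph_image_mul {Ω : Set ℂ} {t : ℝ} (ht : 0 < t) (δ : ℝ) :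
    meshGraph ((fun z : ℂ => (t : ℂ) * z) '' Ω) δ = meshGraph Ω (δ / t) := by
  have ht' : (t : ℂ) ≠ 0 := by exact_mod_cast ht.ne'
  ext x y
  rw [meshGraph_adj_iff, meshGraph_adj_iff]
  refine and_congr_right fun _ => ?_
  rw [← Homeomorph.coe_mulLeft₀ (t : ℂ) ht', ← Homeomorph.image_closure,
    Homeomorph.image_eq_preimage_symm, dl_meshPoint_div δ t, dl_meshPoint_div δ t,
    ← image_mul_left_segment, image_subset_iff, Homeomorph.mulLeft₀_symm_apply]

/-- **The largest mesh component of a dilated domain**: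
`meshDomain (t • Ω) δ = meshDomain Ω (δ / t)` (`t > 0`) — the discretisation of `t • Ω` at mesh
`δ` and of `Ω` at mesh `δ / t` have literally the same vertices and the same mesh graph.
[folklore] -/
theorem dl_meshDomain_image_mul {Ω : Set ℂ} {t : ℝ} (ht : 0 < t) (δ : ℝ) :
    meshDomain ((fun z : ℂ => (t : ℂ) * z) '' Ω) δ = meshDomain Ω (δ / t) := by
  have hV := dl_meshVertices_image_mul (Ω := Ω) ht δ
  have hG := dl_meshGraph_image_mul (Ω := Ω) ht δ
  suffices h : ∀ (V V' : Set (Site 2)) (G G' : SimpleGraph (Site 2)), V = V' → G = G' →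
      (⋃ (C : (G.induce V).ConnectedComponent)
        (_ : ∀ C' : (G.induce V).ConnectedComponent, C'.supp.ncard ≤ C.supp.ncard),
        Subtype.val '' C.supp) =
      ⋃ (C : (G'.induce V').ConnectedComponent)
        (_ : ∀ C' : (G'.induce V').ConnectedComponent, C'.supp.ncard ≤ C.supp.ncard),
        Subtype.val '' C.supp from
    h _ _ _ _ hV hG
  rintro V V' G G' rfl rfl
  rfl

end Dilation

/-! ### Registered one-line form -/

/-- **Registered sub-goal `stub_dilationEquicontinuity_part3`** of `stub_dilationEquicontinuity`
(stmt-CriticalPhenomena-14337): the upper half of the sandwich, one-line form of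
`dl_discreteCrossing_subset_cross`. [folklore] -/
theorem stub_dilationEquicontinuity_part3 : ∀ (Ψ sc : ℂ ≃ₜ ℂ) (β δ : ℝ), 0 < β → (∀ z : ℂ, sc z = ⟨1 * z.re, β * z.im⟩) → 0 < δ → (∀ z ∈ Ψ '' (Set.Icc (-1 : ℝ) 1 ×ℂ Set.Icc (-1 : ℝ) 1), ∀ z' ∈ Ψ '' (Set.Icc (-1 : ℝ) 1 ×ℂ Set.Icc (-1 : ℝ) 1), dist z z' < 2 * δ → dist (Ψ.symm z) (Ψ.symm z') < 1 - β) → Literature.Probability.Percolation.discreteCrossing (Ψ '' (Set.Ioo (-1 : ℝ) 1 ×ℂ Set.Ioo (-1 : ℝ) 1)) δ (Ψ '' {p : ℂ | p.im = -1 ∧ p.re ∈ Set.Icc (-1 : ℝ) 1}) (Ψ '' {p : ℂ | p.im = 1 ∧ p.re ∈ Set.Icc (-1 : ℝ) 1}) ⊆ {ω | ∃ K, (Literature.Probability.Percolation.squareModelQuad (sc.trans Ψ)).IsCrossing K ∧ K ⊆ Literature.Probability.Percolation.openEdgeUnion δ ω} :=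
  fun Ψ sc _ _ hβ hsc hδ hη => dl_discreteCrossing_subset_cross Ψ sc hβ hsc hδ hη

end Summit.CriticalPhenomena.CardyFormulaZ2.Cruxes.PolyominoGaussianLaw.Birth
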